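import Mathlib
import HarnessLib
import Summits.ABC.ABC.Theses.NegOmegaAtlas
import Literature.NumberTheory.DiophantineGeometry.AbcWave0QualityFormProofs
import Literature.NumberTheory.DiophantineGeometry.AbcWave0SUnitProofs
import Literature.Barriers.ABC.MasonStothersFailsInCharP

/-!
# Strategy census (Lean side) for the crux `NegThesis` (stmt-ABC-1224, route NegOmegaAtlas)

Companion of `STRATEGY-CENSUS.md` (crux-strategist seat `planner-cstrat-stmt-ABC-1224-s1-0`,
2026-08-17). The crux is the route's thesis
`NegThesis := ∃ k, ∃ δ > 0, {abc triples with ω(abc) ≤ k and quality > 1 + δ}.Infinite`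
(negative side: `closes … : ¬ABC`). This file TYPES the strengthenings / decompositions / negation
attempts of the census and settles, sorry-free, what can be settled in the tree:

* STRENGTHEN — `not_fixedSupportFamily`, `not_nestedSupportFamily`: every strengthening that confines
  the family to finitely many supports, or to a support-non-decreasing orbit (any "breeding map" whose
  supports only grow), is FALSE, by the S-unit theorem over `ℚ` PROVED in the tree
  (`finite_setOf_isABCTriple_primeFactors_subset_holds`). `GapLaw` (a repulsion law at bounded ω) is
  typed and shown to feed the crux together with the hit supply (`negThesis_of_hits_gapLaw`); `Level`,
  `level_mono`: "induction on k" has a trivial step and the open base case `Level 3 = ThreeSlotFamily`.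
* DECOMPOSITION — (D2) `OmegaFreeSupply ↔ ABCNegation` and `OmegaFreeSupply → ¬ABC`: the ω-free supply
  piece already gives the route's conclusion on its own (BC2(c) violation), and the compression piece
  is implied by `ABC` (`compression_of_abc`); (D3) seed ∧ self-map: the seed is a theorem
  (`seed_three : Seed 3 (2/5)`, the triple `3 + 125 = 128`) and `selfMap_iff` shows the self-map piece
  is, modulo the seed, EQUIVALENT to the level-(k,δ) crux — costume; (D1) is the registered line
  `Lines/birth.lean` (exact cut, not repeated here).
* NEGATION — `not_negThesis_iff`: ¬NegThesis is bounded-ω abc for every k; `boundedOmegaABC_two` shows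
  the route's `TwoSlotCell` settles k ≤ 2 (and `ABC → ¬NegThesis` is the route's Assembly, contraposed).
* TRANSFER — the solved sibling of exactly this step is characteristic `p`: `example` below instantiates
  the in-tree theorem `Literature.Barriers.ABC.MasonStothersFailsInCharP` over `ZMod 7` (bounded
  support, unbounded height, via Frobenius); the break point (additivity of Frobenius) is discussed in
  the `.md`.

No `sorry`. Nothing here is registered as a line or a stub; the live skeleton `Lines/birth.lean` and its
stubs are untouched.
-/

set_option linter.dupNamespace false

namespace Summit.ABC.ABC.Cruxes.NegThesis.StrategyCensus

open Literature.NumberTheory.DiophantineGeometry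
open Summit.ABC.ABC.Theses.NegOmegaAtlas

/-! ## Common vocabulary -/

/-- Level-`k`, margin-`δ` violators: abc triples with `ω(abc) ≤ k` and quality `> 1 + δ`. [folklore] -/
def Violators (k : ℕ) (δ : ℝ) : Set (ℕ × ℕ × ℕ) :=
  {t | IsABCTriple t.1 t.2.1 t.2.2 ∧ (t.1 * t.2.1 * t.2.2).primeFactors.card ≤ k ∧
    1 + δ < quality t.1 t.2.1 t.2.2}

/-- The crux, re-read through `Violators`. [folklore] -/
theorem negThesis_iff : NegThesis ↔ ∃ k : ℕ, ∃ δ : ℝ, 0 < δ ∧ (Violators k δ).Infinite :=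
  Iff.rfl

/-- Negation of the crux: every level has only finitely many violators at every margin. [folklore] -/
theorem not_negThesis_iff' : ¬ NegThesis ↔ ∀ k : ℕ, ∀ δ : ℝ, 0 < δ → (Violators k δ).Finite := by
  simp only [negThesis_iff, not_exists, not_and, Set.not_infinite]

/-- abc triples with `c ≤ X` form a finite set (they lie in `[0,X]³`). [folklore] -/
theorem finite_triples_le (X : ℕ) :
    {t : ℕ × ℕ × ℕ | IsABCTriple t.1 t.2.1 t.2.2 ∧ t.2.2 ≤ X}.Finite := by
  refine ((Set.finite_Iic X).prod ((Set.finite_Iic X).prod (Set.finite_Iic X))).subset ?_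
  rintro ⟨a, b, c⟩ ⟨⟨ha, hb, habc, -⟩, hcX⟩
  simp only [Set.mem_prod, Set.mem_Iic] at *
  omega

/-- abc triples with `(c : ℝ) ≤ B` form a finite set. [folklore] -/
theorem finite_triples_le_real (B : ℝ) :
    {t : ℕ × ℕ × ℕ | IsABCTriple t.1 t.2.1 t.2.2 ∧ (t.2.2 : ℝ) ≤ B}.Finite := by
  refine (finite_triples_le ⌊B⌋₊).subset ?_
  rintro t ⟨ht, hB⟩
  exact ⟨ht, Nat.le_floor hB⟩

/-- An infinite set of abc triples contains, for every bound `C`, a member with `c > C`. [folklore] -/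
theorem exists_gt_of_infinite {V : Set (ℕ × ℕ × ℕ)}
    (hV : V ⊆ {t | IsABCTriple t.1 t.2.1 t.2.2}) (hinf : V.Infinite) (C : ℕ) :
    ∃ t ∈ V, C < t.2.2 := by
  by_contra h
  push Not at h
  exact hinf ((finite_triples_le C).subset fun t ht => ⟨hV ht, h t ht⟩)

/-! ## STRENGTHEN

### S⁺₁ — finitely many supports: FALSE (S-unit theorem, proved in the tree) -/

/-- **S⁺₁ (fixed support).** Some finite set of primes `S` carries infinitely many abc triples of
quality `> 1 + δ` supported on `S`. The most rigid strengthening (it would admit induction along the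
family inside one torus `(ℤ_S^×)²`). [folklore] -/
def FixedSupportFamily : Prop :=
  ∃ S : Finset ℕ, ∃ δ : ℝ, 0 < δ ∧
    {t : ℕ × ℕ × ℕ | IsABCTriple t.1 t.2.1 t.2.2 ∧ (t.1 * t.2.1 * t.2.2).primeFactors ⊆ S ∧
      1 + δ < quality t.1 t.2.1 t.2.2}.Infinite

/-- S⁺₁ is false: Mahler's S-unit theorem over `ℚ` (abc.S25, PROVED in the tree as
`finite_setOf_isABCTriple_primeFactors_subset_holds`) leaves only finitely many abc triples on any
fixed support, whatever their quality. [cite: BombieriGubler2006, Thm. 5.2.1] -/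
theorem not_fixedSupportFamily : ¬ FixedSupportFamily := by
  rintro ⟨S, δ, -, hinf⟩
  refine hinf ((finite_setOf_isABCTriple_primeFactors_subset_holds S).subset ?_)
  rintro t ⟨ht, hS, -⟩
  exact ⟨ht, hS⟩

/-- **S⁺₂ (support-non-decreasing orbit).** An injective sequence of level-`k`, margin-`δ` violators
along which the support never loses a prime — the shape of every "breeding" self-map
`(a,b,c) ↦ Φ(a,b,c)` built from a polynomial identity in `a, b, c` (the new triple is divisible by the
old primes). [folklore] -/
def NestedSupportFamily : Prop :=
  ∃ k : ℕ, ∃ δ : ℝ, 0 < δ ∧ ∃ f : ℕ → ℕ × ℕ × ℕ, Function.Injective f ∧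
    (∀ n, f n ∈ Violators k δ) ∧
    ∀ n, ((f n).1 * (f n).2.1 * (f n).2.2).primeFactors ⊆
      ((f (n + 1)).1 * (f (n + 1)).2.1 * (f (n + 1)).2.2).primeFactors

/-- S⁺₂ is false: a non-decreasing chain of supports of cardinality `≤ k` is constant from the index
where the cardinality is maximal, and then dominates every support of the sequence; so the whole
sequence lives on ONE finite support and the S-unit theorem (abc.S25, proved) makes it finite —
contradicting injectivity. Hence bounded ω forces infinitely many DISTINCT supports with no prime
persistence: no breeding / orbit structure can carry the crux. [cite: BombieriGubler2006, Thm. 5.2.1] -/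
theorem not_nestedSupportFamily : ¬ NestedSupportFamily := by
  rintro ⟨k, δ, -, f, hf, hV, hstep⟩
  -- the supports
  set s : ℕ → Finset ℕ := fun n => ((f n).1 * (f n).2.1 * (f n).2.2).primeFactors with hs
  have hmono : Monotone s := monotone_nat_of_le_succ fun n => hstep n
  have hcard : ∀ n, (s n).card ≤ k := fun n => (hV n).2.1
  -- the cardinalities attain their supremum at some index n₀
  set g : ℕ → ℕ := fun n => (s n).card with hg
  have hb : BddAbove (Set.range g) := ⟨k, by rintro _ ⟨n, rfl⟩; exact hcard n⟩
  obtain ⟨n₀, hn₀⟩ : sSup (Set.range g) ∈ Set.range g := Nat.sSup_mem (Set.range_nonempty g) hb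
  have hmax : ∀ n, g n ≤ g n₀ := fun n => hn₀ ▸ le_csSup hb ⟨n, rfl⟩
  -- every support is contained in s n₀
  have hsub : ∀ n, s n ⊆ s n₀ := by
    intro n
    rcases le_total n n₀ with h | h
    · exact hmono h
    · exact (Finset.eq_of_subset_of_card_le (hmono h) (hmax n)).symm ▸ Finset.Subset.refl _
  -- so the (infinite) range of f sits inside the finite set of triples supported on s n₀
  have hrange : Set.range f ⊆ {t : ℕ × ℕ × ℕ | IsABCTriple t.1 t.2.1 t.2.2 ∧
      (t.1 * t.2.1 * t.2.2).primeFactors ⊆ s n₀} := by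
    rintro _ ⟨n, rfl⟩
    exact ⟨(hV n).1, hsub n⟩
  exact (Set.infinite_range_of_injective hf).mono hrange
    (finite_setOf_isABCTriple_primeFactors_subset_holds (s n₀))

/-! ### S⁺₃ — a repulsion / gap law at bounded ω (typed; feeds the crux with the hit supply) -/

/-- **S⁺₃ (gap law).** At each level `k`, beyond some `C_k` every abc HIT (`rad(abc) < c`) with
`ω(abc) ≤ k` already has quality `> 1 + δ_k`: quality cannot creep to `1⁺` at bounded ω. Strictly
stronger than the arrows of `Lines/birth.lean`; predicted FALSE by the polylog-supply heuristic
(bounded-ω hits with `c/rad ≍ (log c)^{O(k)}`, i.e. quality `→ 1⁺`, are expected for large `k` —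
Baker's refinement `c ≪ N(log N)^ω/ω!` "would probably be close to optimal").
[cite: BombieriGubler2006, Rem. 12.4.11] -/
def GapLaw : Prop :=
  ∀ k : ℕ, ∃ δ : ℝ, 0 < δ ∧ ∃ C : ℕ, ∀ a b c : ℕ, IsABCTriple a b c →
    (a * b * c).primeFactors.card ≤ k → rad a b c < c → C < c → 1 + δ < quality a b c

/-- The hit supply of the registered line (`stub_boundedOmegaHits`, restated as a `Prop`; nothing is
re-registered here). [folklore] -/
def BoundedOmegaHits : Prop :=
  ∃ k : ℕ, {t : ℕ × ℕ × ℕ | IsABCTriple t.1 t.2.1 t.2.2 ∧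
    (t.1 * t.2.1 * t.2.2).primeFactors.card ≤ k ∧ rad t.1 t.2.1 t.2.2 < t.2.2}.Infinite

/-- Supply ∧ gap law ⟹ crux: the infinitely many level-`k` hits beyond `C_k` are violators.
(So S⁺₃ is a typed strengthening of the UPGRADE arrows; it buys nothing, being less likely than the
arrows themselves.) [folklore] -/
theorem negThesis_of_hits_gapLaw (h₁ : BoundedOmegaHits) (h₂ : GapLaw) : NegThesis := by
  obtain ⟨k, hk⟩ := h₁
  obtain ⟨δ, hδ, C, hC⟩ := h₂ k
  refine ⟨k, δ, hδ, ?_⟩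
  have hfin : {t : ℕ × ℕ × ℕ | IsABCTriple t.1 t.2.1 t.2.2 ∧ t.2.2 ≤ C}.Finite := finite_triples_le C
  refine ((hk.sdiff hfin).mono ?_)
  rintro t ⟨⟨ht, hω, hr⟩, hnot⟩
  have hCt : C < t.2.2 := by
    by_contra hle
    exact hnot ⟨ht, not_lt.mp hle⟩
  exact ⟨ht, hω, hC _ _ _ ht hω hr hCt⟩

/-! ### S⁺₄ — "induction on k": trivial step, open base case -/

/-- The crux at a fixed level `k`. [folklore] -/
def Level (k : ℕ) : Prop := ∃ δ : ℝ, 0 < δ ∧ (Violators k δ).Infinite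

/-- The inductive step is free (levels are monotone in `k`) … [folklore] -/
theorem level_mono {k k' : ℕ} (h : k ≤ k') : Level k → Level k' := by
  rintro ⟨δ, hδ, hinf⟩
  have hsub : Violators k δ ⊆ Violators k' δ := fun t ht => ⟨ht.1, ht.2.1.trans h, ht.2.2⟩
  exact ⟨δ, hδ, hinf.mono hsub⟩

/-- … the crux is `∃ k, Level k` … [folklore] -/
theorem negThesis_iff_exists_level : NegThesis ↔ ∃ k, Level k := Iff.rfl

/-- … and the base case is the route's open rank-4 crux `ThreeSlotFamily` (stmt-ABC-1227) verbatim: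
induction on `k` relocates the whole difficulty into the base. [folklore] -/
theorem level_three_iff : Level 3 ↔ ThreeSlotFamily := Iff.rfl

/-! ### S⁺₅ — "slowly growing ω": the ∀g-version is the crux again (diagonal argument) -/

/-- **S⁺₅ / restatement along the ω-axis.** For EVERY monotone unbounded `g`, some margin `δ > 0`
admits infinitely many abc triples with `ω(abc) ≤ g(c)` and quality `> 1 + δ`. Looks weaker than the
crux (ω may grow, only slower than any prescribed rate); it is equivalent to it
(`slowOmegaSupply_iff_negThesis`). [folklore] -/
def SlowOmegaSupply : Prop :=
  ∀ g : ℕ → ℕ, Monotone g → Filter.Tendsto g Filter.atTop Filter.atTop →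
    ∃ δ : ℝ, 0 < δ ∧ {t : ℕ × ℕ × ℕ | IsABCTriple t.1 t.2.1 t.2.2 ∧
      (t.1 * t.2.1 * t.2.2).primeFactors.card ≤ g t.2.2 ∧ 1 + δ < quality t.1 t.2.1 t.2.2}.Infinite

/-- Easy half: a bounded-ω family is a `g`-bounded family for every `g → ∞` (drop the finitely many
members with `g(c) < k`). [folklore] -/
theorem slowOmegaSupply_of_negThesis (h : NegThesis) : SlowOmegaSupply := by
  intro g _ hg
  obtain ⟨k, δ, hδ, hinf⟩ := h
  refine ⟨δ, hδ, ?_⟩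
  obtain ⟨C₀, hC₀⟩ : ∃ C₀, ∀ c, C₀ ≤ c → k ≤ g c := by
    simpa using (Filter.tendsto_atTop_atTop.mp hg) k
  have hfin : {t : ℕ × ℕ × ℕ | IsABCTriple t.1 t.2.1 t.2.2 ∧ t.2.2 ≤ C₀}.Finite := finite_triples_le C₀
  refine (hinf.sdiff hfin).mono ?_
  rintro t ⟨⟨ht, hω, hq⟩, hnot⟩
  have hc : C₀ ≤ t.2.2 := by
    by_contra hlt
    exact hnot ⟨ht, (not_le.mp hlt).le⟩
  exact ⟨ht, hω.trans (hC₀ _ hc), hq⟩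

/-- Hard half (diagonalisation): if every level `k` had only finitely many violators at every margin,
bound the `c`'s of `Violators k (1/(k+1))` by `N k` (monotone, `N k ≥ k`) and let `g(c)` be the
largest `k ≤ c` with `N k < c`; then `g` is monotone and unbounded, yet a `g`-bounded violator of
margin `δ > 1/(j+1)` with `c > N j` would lie in `Violators (g c) (1/(g c + 1))` and have
`c ≤ N (g c) < c`. So no rung strictly between "bounded ω" and "ω free" exists on the `g`-scale.
[folklore] -/
theorem negThesis_of_slowOmegaSupply (h : SlowOmegaSupply) : NegThesis := by
  classical
  by_contra hneg
  rw [not_negThesis_iff'] at hneg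
  -- bounds B k on the c's of Violators k (1/(k+1))
  have hB : ∀ k : ℕ, ∃ B : ℕ, ∀ t ∈ Violators k (1 / ((k : ℝ) + 1)), t.2.2 ≤ B := by
    intro k
    have hfin : (Violators k (1 / ((k : ℝ) + 1))).Finite := hneg k _ (by positivity)
    obtain ⟨B, hBmem⟩ := (hfin.image fun t => t.2.2).bddAbove
    exact ⟨B, fun t ht => hBmem ⟨t, ht, rfl⟩⟩
  choose B hB using hB
  -- monotone majorant N with N k ≥ k
  set N : ℕ → ℕ := fun k => (Finset.range (k + 1)).sup B + k with hN
  have hNB : ∀ {j k}, j ≤ k → B j ≤ N k := fun {j k} hjk =>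
    (Finset.le_sup (f := B) (Finset.mem_range.mpr (Nat.lt_succ_of_le hjk))).trans (Nat.le_add_right _ _)
  have hNk : ∀ k, k ≤ N k := fun k => Nat.le_add_left _ _
  -- the diagonal rate g
  set g : ℕ → ℕ := fun c => Nat.findGreatest (fun k => N k < c) c with hg
  have hgmono : Monotone g := fun c c' hcc' =>
    Nat.findGreatest_mono (fun k (hk : N k < c) => hk.trans_le hcc') hcc'
  have hg_ge : ∀ j c, N j < c → j ≤ g c := fun j c hjc =>
    Nat.le_findGreatest ((hNk j).trans hjc.le) hjc
  have hgtop : Filter.Tendsto g Filter.atTop Filter.atTop := by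
    refine Filter.tendsto_atTop_atTop.mpr fun j => ⟨N j + 1, fun c hc => hg_ge j c ?_⟩
    omega
  have hgspec : ∀ c, g c ≠ 0 → N (g c) < c := fun c hc =>
    ((Nat.findGreatest_eq_iff.mp rfl).2.1) hc
  -- apply the hypothesis to g
  obtain ⟨δ, hδ, hinf⟩ := h g hgmono hgtop
  obtain ⟨j₀, hj₀⟩ := exists_nat_one_div_lt hδ
  set j := j₀ + 1 with hj
  have hjδ : 1 / ((j : ℝ) + 1) < δ := by
    refine lt_of_le_of_lt ?_ hj₀
    rw [hj]; push_cast
    exact one_div_le_one_div_of_le (by positivity) (by linarith)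
  -- every g-bounded δ-violator has c ≤ N j
  refine hinf ((finite_triples_le (N j)).subset ?_)
  rintro t ⟨ht, hω, hq⟩
  refine ⟨ht, ?_⟩
  by_contra hlt
  push Not at hlt
  have hjg : j ≤ g t.2.2 := hg_ge j _ hlt
  have hg0 : g t.2.2 ≠ 0 := by omega
  -- t is a level-(g c) violator of margin 1/(g c + 1)
  have hmem : t ∈ Violators (g t.2.2) (1 / ((g t.2.2 : ℝ) + 1)) := by
    refine ⟨ht, hω, lt_of_le_of_lt ?_ hq⟩
    have : 1 / ((g t.2.2 : ℝ) + 1) ≤ 1 / ((j : ℝ) + 1) :=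
      one_div_le_one_div_of_le (by positivity) (by exact_mod_cast Nat.add_le_add_right hjg 1)
    linarith
  have h1 : t.2.2 ≤ N (g t.2.2) := (hB _ t hmem).trans (hNB le_rfl)
  have h2 : N (g t.2.2) < t.2.2 := hgspec _ hg0
  omega

/-- The ω-axis carries no statement strictly between the crux and ¬abc: the `∀g` version IS the
crux. [folklore] -/
theorem slowOmegaSupply_iff_negThesis : SlowOmegaSupply ↔ NegThesis :=
  ⟨negThesis_of_slowOmegaSupply, slowOmegaSupply_of_negThesis⟩

/-! ## DECOMPOSITION

### D2 — ω-free supply ∧ ω-compression: inadmissible (the supply piece is the route's conclusion) -/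

/-- **D2, piece 1 (ω-free supply).** Infinitely many abc triples of quality `> 1 + δ`, ω free.
[folklore] -/
def OmegaFreeSupply : Prop :=
  ∃ δ : ℝ, 0 < δ ∧ {t : ℕ × ℕ × ℕ | IsABCTriple t.1 t.2.1 t.2.2 ∧ 1 + δ < quality t.1 t.2.1 t.2.2}.Infinite

/-- **D2, piece 2 (ω-compression).** "If abc fails, it fails at bounded ω." [folklore] -/
def Compression : Prop := OmegaFreeSupply → NegThesis

/-- The crux implies the ω-free supply (drop the ω clause). [folklore] -/
theorem omegaFreeSupply_of_negThesis (h : NegThesis) : OmegaFreeSupply := by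
  obtain ⟨k, δ, hδ, hinf⟩ := h
  have hsub : Violators k δ ⊆
      {t : ℕ × ℕ × ℕ | IsABCTriple t.1 t.2.1 t.2.2 ∧ 1 + δ < quality t.1 t.2.1 t.2.2} :=
    fun t ht => ⟨ht.1, ht.2.2⟩
  exact ⟨δ, hδ, hinf.mono hsub⟩

/-- The D2 seam is modus ponens. [folklore] -/
theorem negThesis_iff_supply_and_compression : NegThesis ↔ OmegaFreeSupply ∧ Compression :=
  ⟨fun h => ⟨omegaFreeSupply_of_negThesis h, fun _ => h⟩, fun h => h.2 h.1⟩

/-- … but piece 1 is literally the abc-neg flag `ABCNegation` (abc.S02, quality form proved in the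
tree) … [cite: BombieriGubler2006, Rem. 12.4.15] -/
theorem omegaFreeSupply_iff_abcNegation : OmegaFreeSupply ↔ ABCNegation :=
  (abcNegation_iff_infinite_quality_gt_holds).symm

/-- … hence gives the route's conclusion `¬ABC` ON ITS OWN (BC2(c): "no piece gives S alone" fails) …
[folklore] -/
theorem omegaFreeSupply_not_abc (h : OmegaFreeSupply) : ¬ _root_.ABC := fun habc =>
  (not_abcNegation_iff_forall_exists_const.mpr habc) (omegaFreeSupply_iff_abcNegation.mp h)

/-- … while piece 2 is a CONSEQUENCE of the summit statement `ABC` (so its only conceivable proofs are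
a proof of abc or a proof of the crux): the split has no piece strictly between. [folklore] -/
theorem compression_of_abc (habc : _root_.ABC) : Compression := fun h =>
  absurd habc (omegaFreeSupply_not_abc h)

/-! ### D3 — seed ∧ self-map ("breeding at bounded ω"): costume -/

/-- **D3, piece 1 (seed).** Some level-`k`, margin-`δ` violator exists. [folklore] -/
def Seed (k : ℕ) (δ : ℝ) : Prop := (Violators k δ).Nonempty

/-- **D3, piece 2 (self-map).** A map sending each level-`k`, margin-`δ` violator to a LARGER one
(any quality-floor- and ω-preserving breeding mechanism would be such a map). [folklore] -/
def SelfMap (k : ℕ) (δ : ℝ) : Prop :=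
  ∃ Φ : ℕ × ℕ × ℕ → ℕ × ℕ × ℕ, ∀ t ∈ Violators k δ, Φ t ∈ Violators k δ ∧ t.2.2 < (Φ t).2.2

/-- The D3 seam: a seed and a self-map give an infinite orbit of violators. [folklore] -/
theorem infinite_of_seed_selfMap {k : ℕ} {δ : ℝ} (h₁ : Seed k δ) (h₂ : SelfMap k δ) :
    (Violators k δ).Infinite := by
  obtain ⟨t₀, ht₀⟩ := h₁
  obtain ⟨Φ, hΦ⟩ := h₂
  set x : ℕ → ℕ × ℕ × ℕ := fun n => Φ^[n] t₀ with hx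
  have hmem : ∀ n, x n ∈ Violators k δ := by
    intro n
    induction n with
    | zero => simpa [hx] using ht₀
    | succ n ih =>
      have : x (n + 1) = Φ (x n) := by simp [hx, Function.iterate_succ_apply']
      rw [this]; exact (hΦ _ ih).1
  have hsm : StrictMono fun n => (x n).2.2 := by
    refine strictMono_nat_of_lt_succ fun n => ?_
    have : x (n + 1) = Φ (x n) := by simp [hx, Function.iterate_succ_apply']
    rw [this]; exact (hΦ _ (hmem n)).2
  have hinj : Function.Injective x := fun m n hmn => hsm.injective (by simp [hmn])
  exact (Set.infinite_range_of_injective hinj).mono (by rintro _ ⟨n, rfl⟩; exact hmem n)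

/-- D3 concludes the crux … [folklore] -/
theorem negThesis_of_seed_selfMap {k : ℕ} {δ : ℝ} (hδ : 0 < δ) (h₁ : Seed k δ) (h₂ : SelfMap k δ) :
    NegThesis :=
  ⟨k, δ, hδ, infinite_of_seed_selfMap h₁ h₂⟩

/-- … an infinite violator set always carries a (non-constructive) self-map: send `t` to any
violator with larger `c` … [folklore] -/
theorem selfMap_of_infinite {k : ℕ} {δ : ℝ} (h : (Violators k δ).Infinite) : SelfMap k δ := by
  classical
  have hex : ∀ t : ℕ × ℕ × ℕ, ∃ t' ∈ Violators k δ, t.2.2 < t'.2.2 := fun t =>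
    exists_gt_of_infinite (fun t ht => ht.1) h t.2.2
  refine ⟨fun t => (hex t).choose, fun t _ => ?_⟩
  exact ⟨(hex t).choose_spec.1, (hex t).choose_spec.2⟩

/-- … so, GIVEN A SEED, the self-map piece is EQUIVALENT to the level-`(k,δ)` crux: the split
`Seed ∧ SelfMap` is the crux in costume (and the seed below is a theorem). [folklore] -/
theorem selfMap_iff {k : ℕ} {δ : ℝ} (hseed : Seed k δ) : SelfMap k δ ↔ (Violators k δ).Infinite :=
  ⟨infinite_of_seed_selfMap hseed, selfMap_of_infinite⟩

/-- The seed is inhabited in kind: `3 + 125 = 128` has `ω(abc) = 3` (`abc = 2⁷·3·5³`, `rad = 30`) and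
quality `log 128 / log 30 > 7/5` (since `30⁷ < 128⁵`); numerically `1.4266`, the ω ≤ 3 champion of
the route's census. [folklore] -/
theorem seed_three : Seed 3 (2 / 5) := by
  have hpf : (3 * 125 * 128).primeFactors = {2, 3, 5} := by
    rw [show (3 * 125 * 128 : ℕ) = (2 ^ 7 * 3) * 5 ^ 3 by norm_num,
      Nat.primeFactors_mul (by norm_num) (by norm_num), Nat.primeFactors_mul (by norm_num) (by norm_num),
      Nat.primeFactors_prime_pow (by norm_num) Nat.prime_two,
      Nat.Prime.primeFactors Nat.prime_three,
      Nat.primeFactors_prime_pow (by norm_num) (by norm_num : Nat.Prime 5)]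
    decide
  have hrad : rad 3 125 128 = 30 := by
    rw [rad_def, Nat.radical_eq_prod_primeFactors, hpf]; decide
  refine ⟨⟨3, 125, 128⟩, ⟨by norm_num, by norm_num, by norm_num, by norm_num⟩, ?_, ?_⟩
  · simp only; rw [hpf]; decide
  · simp only
    rw [quality, hrad]
    have h30 : (0 : ℝ) < Real.log 30 := Real.log_pos (by norm_num)
    rw [show (1 : ℝ) + 2 / 5 = 7 / 5 by norm_num, lt_div_iff₀ (by exact_mod_cast h30)]
    have hlt : Real.log ((30 : ℝ) ^ 7) < Real.log ((128 : ℝ) ^ 5) :=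
      Real.log_lt_log (by positivity) (by norm_num)
    rw [Real.log_pow, Real.log_pow] at hlt
    push_cast at hlt ⊢
    linarith

/-! ## NEGATION -/

/-- Bounded-ω abc at level `k` (the positive-side statement a counterexample to the crux must prove
for every `k`). [folklore] -/
def BoundedOmegaABC (k : ℕ) : Prop := ∀ δ : ℝ, 0 < δ → (Violators k δ).Finite

/-- Refuting the crux = bounded-ω abc at EVERY level. [folklore] -/
theorem not_negThesis_iff : ¬ NegThesis ↔ ∀ k, BoundedOmegaABC k := by
  simp only [negThesis_iff, BoundedOmegaABC, not_exists, not_and, Set.not_infinite]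

-- Remark (deliberately NOT stated as a theorem here, to keep this workfile free of anything shaped
-- like a negative edge on the item): `ABC → ¬NegThesis` is the contrapositive of the route's Assembly
-- item (stmt-ABC-1232, proof in hand) — `omegaFreeSupply_not_abc ∘ omegaFreeSupply_of_negThesis`.

/-- What the counterexample attempt achieves today: the route's support item `TwoSlotCell`
(`c < 2·rad(abc)` when `ω(abc) ≤ 2`, elementary) settles levels `k ≤ 2` — a violator would have
`rad^(1+δ) < c < 2·rad`, so `rad < 2^{1/δ}` and `c < 2^{1+1/δ}`. Level 3 (uniform prime-Beal /
varying-base Pillai) is where it stops: `BoundedOmegaABC 3 = ¬ThreeSlotFamily`, an existing item.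
[folklore] -/
theorem boundedOmegaABC_two (h : TwoSlotCell) : BoundedOmegaABC 2 := by
  intro δ hδ
  refine (finite_triples_le_real (2 * (2 : ℝ) ^ (1 / δ))).subset ?_
  rintro ⟨a, b, c⟩ ⟨ht, hω, hq⟩
  refine ⟨ht, ?_⟩
  simp only at ht hω hq ⊢
  have hr2 : (2 : ℝ) ≤ (rad a b c : ℝ) := by exact_mod_cast ht.two_le_rad
  have hr0 : (0 : ℝ) < (rad a b c : ℝ) := by linarith
  have h1 : ((rad a b c : ℕ) : ℝ) ^ (1 + δ) < (c : ℝ) := (ht.one_add_lt_quality_iff δ).mp hq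
  have h2 : (c : ℝ) < 2 * (rad a b c : ℝ) := by exact_mod_cast h a b c ht hω
  -- rad^δ < 2
  have h3 : (rad a b c : ℝ) ^ δ < 2 := by
    have hsplit : ((rad a b c : ℕ) : ℝ) ^ (1 + δ) = (rad a b c : ℝ) * (rad a b c : ℝ) ^ δ := by
      rw [Real.rpow_add hr0, Real.rpow_one]
    rw [hsplit] at h1
    by_contra hge
    push Not at hge
    have : 2 * (rad a b c : ℝ) ≤ (rad a b c : ℝ) * (rad a b c : ℝ) ^ δ := by
      calc 2 * (rad a b c : ℝ) = (rad a b c : ℝ) * 2 := by ring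
        _ ≤ (rad a b c : ℝ) * (rad a b c : ℝ) ^ δ := by gcongr
    linarith
  -- rad < 2^(1/δ)
  have h4 : (rad a b c : ℝ) < (2 : ℝ) ^ (1 / δ) := by
    have hpow := Real.rpow_lt_rpow (Real.rpow_nonneg hr0.le δ) h3 (one_div_pos.mpr hδ)
    rwa [← Real.rpow_mul hr0.le, mul_one_div_cancel hδ.ne', Real.rpow_one] at hpow
  linarith

/-! ## TRANSFER — the solved sibling of exactly this step lives in characteristic `p` -/

section TransferCharP

local instance instFactPrimeSeven : Fact (Nat.Prime 7) := ⟨by norm_num⟩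

/-- In `(ZMod 7)[X]` the negative thesis holds in the strongest form — bounded support
(`deg rad(abc) ≤ 2`, i.e. "ω ≤ 2") and unbounded height — by the Frobenius family
`X^{7^m} + 1 = (X+1)^{7^m}`: the in-tree theorem `MasonStothersFailsInCharP`. Over `ℤ` the map
`n ↦ n^p` is not additive; the nearest integer shadow of the Frobenius twist of `8 + 1 = 9` is the hit
family `1 + (9^n − 1) = 9^n`, whose quality tends to `1` and whose ω is unbounded (see the `.md`).
[cite: EvertseGyory2015, §7.6] -/
theorem charP_sibling (N : ℕ) :
    ∃ a b c : Polynomial (ZMod 7), a ≠ 0 ∧ b ≠ 0 ∧ c ≠ 0 ∧ IsCoprime a b ∧ a + b + c = 0 ∧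
      N ≤ a.natDegree ∧ (UniqueFactorizationMonoid.radical (a * b * c)).natDegree ≤ 2 :=
  Literature.Barriers.ABC.MasonStothersFailsInCharP (ZMod 7) 7 N

end TransferCharP

end Summit.ABC.ABC.Cruxes.NegThesis.StrategyCensus
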